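import Summits.RiemannHypothesis.RiemannHypothesis.Theorems.WeilFormatCWindowPolarization
import Summits.RiemannHypothesis.RiemannHypothesis.Theorems.WeilFormatCWindowSectors
import Summits.RiemannHypothesis.RiemannHypothesis.Theorems.WeilFormatCPolyWindowIncrement
import HarnessLib

/-!
# Format C: reflection invariance of the sesquilinear window form; parity selection rules for the C∞ entries

Route context: Fourier–Galerkin / Schur-complement certificates of Weil positivity on a window ("format C";
cell memo `run/shared/lean/pub/rh-explicit/rh-explicit-weil-10/FORMATC-DESIGN.md` §1 (c1), §9.13; supporting
stmt-RiemannHypothesis-0098; seat rh-explicit-weil-10).  The window form is invariant under the reflection `x ↦ −x`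
(`weilDirichletEnergy_comp_neg`; the pole and `L²` pieces by the evenness of `cosh` and oddness of `sinh`); by
polarization so is the sesquilinear form.  Consequences used by the per-sector C∞ doors (KERNEL-LEVER.md §17):

* `IsWindowFunction.comp_neg`, `weilWindowForm_comp_neg`, **`weilWindowSesq_comp_neg`** —
  `W_a(u(−·), v(−·)) = W_a(u, v)` for window functions;
* `weilWindowSesq_eq_zero_of_even_odd` — an even and an odd window function are `W_a`-orthogonal;
* monomial windows: `1x^j(−x) = (−1)^j 1x^j(x)`, hence **`weilWindowSesq_indicator_pow_eq_zero_of_odd`**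
  (`W_a(1x^j, 1x^k) = 0` for `j + k` odd) and **`weilWindowSesq_indicator_pow_chi_neg`**
  (`W_a(1x^j, χ_{−m}) = (−1)^j W_a(1x^j, χ_m)`), so the sector columns are
  `W_a(1x^j, chiEven a i) = ((1 + (−1)^j)/√2)·W_a(1x^j, χ_i)` (`i ≥ 1`) and
  `W_a(1x^j, chiOdd a i) = ((1 − (−1)^j)/√2)·W_a(1x^j, χ_i)` — even profiles see only the even sector, odd only the odd.

Pure bookkeeping; standard axioms; no RH claim.
-/

set_option autoImplicit false
-- `Summit.RiemannHypothesis.RiemannHypothesis.…` is the layout-mandated namespace (summit = problem name).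
set_option linter.dupNamespace false

noncomputable section

open Complex Filter Set MeasureTheory
open scoped Real Topology ComplexConjugate

namespace Summit.RiemannHypothesis.RiemannHypothesis.Theorems.WeilFormatC

open Literature.NumberTheory.LFunctions Literature.NumberTheory.LFunctions.Yoshida1992

variable {a : ℝ} {u v : ℝ → ℂ}

/-! ## Reflection invariance -/

/-- The reflection of a window function is a window function. -/
theorem IsWindowFunction.comp_neg (hu : IsWindowFunction a u) : IsWindowFunction a (fun x ↦ u (-x)) := by
  obtain ⟨S, hS⟩ := hu.bounded
  obtain ⟨L, hL⟩ := hu.lipschitz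
  refine ⟨hu.measurable.comp measurable_neg, fun x hx ↦ hu.eq_zero (-x) fun h ↦ hx ?_, ⟨S, fun x ↦ hS (-x)⟩,
    ⟨L, fun x y hx hy ↦ ?_⟩⟩
  · rw [mem_Icc] at h ⊢
    constructor <;> linarith [h.1, h.2]
  · have hx' : -x ∈ Icc (-a) a := by rw [mem_Icc] at hx ⊢; constructor <;> linarith [hx.1, hx.2]
    have hy' : -y ∈ Icc (-a) a := by rw [mem_Icc] at hy ⊢; constructor <;> linarith [hy.1, hy.2]
    have h := hL (-x) (-y) hx' hy'
    rwa [show |(-y) - (-x)| = |y - x| by rw [abs_sub_comm]; ring_nf] at h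

/-- The pole form is reflection invariant (`cosh` even, `sinh` odd). -/
theorem weilPoleForm_comp_neg (u : ℝ → ℂ) : weilPoleForm (fun x ↦ u (-x)) = weilPoleForm u := by
  unfold weilPoleForm
  have hc : ∫ t : ℝ, u (-t) * (Real.cosh (t / 2) : ℂ) = ∫ t : ℝ, u t * (Real.cosh (t / 2) : ℂ) := by
    have h := integral_neg_eq_self (fun t : ℝ ↦ u t * (Real.cosh (t / 2) : ℂ)) volume
    simp only [neg_div, Real.cosh_neg] at h
    rw [← h]
  have hs : ∫ t : ℝ, u (-t) * (Real.sinh (t / 2) : ℂ) = -∫ t : ℝ, u t * (Real.sinh (t / 2) : ℂ) := by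
    have h := integral_neg_eq_self (fun t : ℝ ↦ u t * (Real.sinh (t / 2) : ℂ)) volume
    simp only [neg_div, Real.sinh_neg, Complex.ofReal_neg, mul_neg] at h
    rw [integral_neg] at h
    rw [← neg_eq_iff_eq_neg.2 h.symm]
  rw [hc, hs, norm_neg]

/-- **The window form is reflection invariant**: `weilWindowForm a (u(−·)) = weilWindowForm a u`. -/
theorem weilWindowForm_comp_neg (a : ℝ) (u : ℝ → ℂ) : weilWindowForm a (fun x ↦ u (-x)) = weilWindowForm a u := by
  unfold weilWindowForm
  rw [weilPoleForm_comp_neg, weilDirichletEnergy_comp_neg]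
  have h := integral_neg_eq_self (fun x : ℝ ↦ ‖u x‖ ^ 2) volume
  rw [h]

/-- **The sesquilinear window form is reflection invariant** (window functions, `a ≥ 0`):
`W_a(u(−·), v(−·)) = W_a(u, v)`. -/
theorem weilWindowSesq_comp_neg (ha : 0 ≤ a) (hu : IsWindowFunction a u) (hv : IsWindowFunction a v) :
    weilWindowSesq a (fun x ↦ u (-x)) (fun x ↦ v (-x)) = weilWindowSesq a u v := by
  rw [weilWindowSesq_polarization ha hu.comp_neg hv.comp_neg, weilWindowSesq_polarization ha hu hv]
  have e : ∀ c : ℂ, ((fun x ↦ u (-x)) + c • fun x ↦ v (-x)) = fun x ↦ (u + c • v) (-x) := by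
    intro c; funext x; simp only [Pi.add_apply, Pi.smul_apply, smul_eq_mul]
  simp only [e, weilWindowForm_comp_neg]

/-! ## Parity selection rules -/

/-- **An even and an odd window function are `W_a`-orthogonal** (`a ≥ 0`). -/
theorem weilWindowSesq_eq_zero_of_even_odd (ha : 0 ≤ a) (hu : IsWindowFunction a u) (hv : IsWindowFunction a v)
    (heven : ∀ x, u (-x) = u x) (hodd : ∀ x, v (-x) = -v x) : weilWindowSesq a u v = 0 := by
  have h := weilWindowSesq_comp_neg ha hu hv
  have e1 : (fun x ↦ u (-x)) = u := funext heven
  have e2 : (fun x ↦ v (-x)) = (-1 : ℂ) • v := by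
    funext x; simp only [hodd, Pi.smul_apply, smul_eq_mul]; ring
  rw [e1, e2, weilWindowSesq_smul_right, map_neg, map_one] at h
  linear_combination (-1 / 2 : ℂ) * h

/-- **An odd and an even window function are `W_a`-orthogonal** (`a ≥ 0`). -/
theorem weilWindowSesq_eq_zero_of_odd_even (ha : 0 ≤ a) (hu : IsWindowFunction a u) (hv : IsWindowFunction a v)
    (hodd : ∀ x, u (-x) = -u x) (heven : ∀ x, v (-x) = v x) : weilWindowSesq a u v = 0 := by
  rw [weilWindowSesq_conj_symm, weilWindowSesq_eq_zero_of_even_odd ha hv hu heven hodd, map_zero]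

/-- Reflection of a monomial window: `1x^j(−x) = (−1)^j · 1x^j(x)`. -/
theorem indicator_pow_neg_apply (a : ℝ) (j : ℕ) (x : ℝ) :
    (Icc (-a) a).indicator (fun y : ℝ ↦ ((y : ℂ)) ^ j) (-x) =
      (-1 : ℂ) ^ j * (Icc (-a) a).indicator (fun y : ℝ ↦ ((y : ℂ)) ^ j) x := by
  by_cases hx : x ∈ Icc (-a) a
  · have hx' : -x ∈ Icc (-a) a := by rw [mem_Icc] at hx ⊢; constructor <;> linarith [hx.1, hx.2]
    rw [indicator_of_mem hx', indicator_of_mem hx]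
    push_cast
    ring
  · have hx' : -x ∉ Icc (-a) a := fun h ↦ hx (by rw [mem_Icc] at h ⊢; constructor <;> linarith [h.1, h.2])
    rw [indicator_of_notMem hx', indicator_of_notMem hx, mul_zero]

/-- **Parity of the monomial entries**: `W_a(1x^j, 1x^k) = (−1)^{j+k} W_a(1x^j, 1x^k)` (`a ≥ 0`). -/
theorem weilWindowSesq_indicator_pow_parity (ha : 0 ≤ a) (j k : ℕ) :
    weilWindowSesq a ((Icc (-a) a).indicator fun x : ℝ ↦ ((x : ℂ)) ^ j) ((Icc (-a) a).indicator fun x : ℝ ↦ ((x : ℂ)) ^ k) =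
      (-1 : ℂ) ^ (j + k) * weilWindowSesq a ((Icc (-a) a).indicator fun x : ℝ ↦ ((x : ℂ)) ^ j)
        ((Icc (-a) a).indicator fun x : ℝ ↦ ((x : ℂ)) ^ k) := by
  have h := weilWindowSesq_comp_neg ha (isWindowFunction_indicator_pow a j) (isWindowFunction_indicator_pow a k)
  have e1 : (fun x ↦ (Icc (-a) a).indicator (fun y : ℝ ↦ ((y : ℂ)) ^ j) (-x)) =
      (-1 : ℂ) ^ j • (Icc (-a) a).indicator (fun y : ℝ ↦ ((y : ℂ)) ^ j) := by
    funext x; rw [indicator_pow_neg_apply, Pi.smul_apply, smul_eq_mul]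
  have e2 : (fun x ↦ (Icc (-a) a).indicator (fun y : ℝ ↦ ((y : ℂ)) ^ k) (-x)) =
      (-1 : ℂ) ^ k • (Icc (-a) a).indicator (fun y : ℝ ↦ ((y : ℂ)) ^ k) := by
    funext x; rw [indicator_pow_neg_apply, Pi.smul_apply, smul_eq_mul]
  rw [e1, e2, weilWindowSesq_smul_left, weilWindowSesq_smul_right, map_pow, map_neg, map_one] at h
  rw [pow_add]
  linear_combination -h

/-- **The monomial table is parity-diagonal**: `W_a(1x^j, 1x^k) = 0` when `j + k` is odd (`a ≥ 0`). -/
theorem weilWindowSesq_indicator_pow_eq_zero_of_odd (ha : 0 ≤ a) {j k : ℕ} (hjk : Odd (j + k)) :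
    weilWindowSesq a ((Icc (-a) a).indicator fun x : ℝ ↦ ((x : ℂ)) ^ j)
      ((Icc (-a) a).indicator fun x : ℝ ↦ ((x : ℂ)) ^ k) = 0 := by
  have h := weilWindowSesq_indicator_pow_parity ha j k
  rw [hjk.neg_one_pow] at h
  linear_combination h / 2

/-- **Reflection of the mixed entries**: `W_a(1x^j, χ_{−m}) = (−1)^j W_a(1x^j, χ_m)` (`a > 0`). -/
theorem weilWindowSesq_indicator_pow_chi_neg (ha : 0 < a) (j : ℕ) (m : ℤ) :
    weilWindowSesq a ((Icc (-a) a).indicator fun x : ℝ ↦ ((x : ℂ)) ^ j) (chi a (-m)) =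
      (-1 : ℂ) ^ j * weilWindowSesq a ((Icc (-a) a).indicator fun x : ℝ ↦ ((x : ℂ)) ^ j) (chi a m) := by
  have h := weilWindowSesq_comp_neg ha.le (isWindowFunction_indicator_pow a j) (isWindowFunction_chi ha m)
  have e1 : (fun x ↦ (Icc (-a) a).indicator (fun y : ℝ ↦ ((y : ℂ)) ^ j) (-x)) =
      (-1 : ℂ) ^ j • (Icc (-a) a).indicator (fun y : ℝ ↦ ((y : ℂ)) ^ j) := by
    funext x; rw [indicator_pow_neg_apply, Pi.smul_apply, smul_eq_mul]
  have e2 : (fun x ↦ chi a m (-x)) = chi a (-m) := funext fun x ↦ chi_neg_apply a m x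
  rw [e1, e2, weilWindowSesq_smul_left] at h
  have hsq : ((-1 : ℂ) ^ j) * ((-1 : ℂ) ^ j) = 1 := by rw [← mul_pow]; norm_num
  linear_combination ((-1 : ℂ) ^ j) * h - (weilWindowSesq a ((Icc (-a) a).indicator fun x : ℝ ↦ ((x : ℂ)) ^ j)
    (chi a (-m))) * hsq

/-- **Even-sector columns**: `W_a(1x^j, chiEven a i) = ((1 + (−1)^j)/√2)·W_a(1x^j, χ_i)` for `i ≠ 0` (`a > 0`) —
odd profiles do not see the even sector. -/
theorem weilWindowSesq_indicator_pow_chiEven (ha : 0 < a) (j : ℕ) {i : ℕ} (hi : i ≠ 0) :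
    weilWindowSesq a ((Icc (-a) a).indicator fun x : ℝ ↦ ((x : ℂ)) ^ j) (chiEven a i) =
      (((1 / Real.sqrt 2 : ℝ) : ℂ) * (1 + (-1 : ℂ) ^ j)) *
        weilWindowSesq a ((Icc (-a) a).indicator fun x : ℝ ↦ ((x : ℂ)) ^ j) (chi a i) := by
  unfold chiEven
  rw [if_neg hi, weilWindowSesq_smul_right, Complex.conj_ofReal,
    weilWindowSesq_add_right ha.le (isWindowFunction_indicator_pow a j) (isWindowFunction_chi ha _)
      (isWindowFunction_chi ha _), weilWindowSesq_indicator_pow_chi_neg ha]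
  ring

/-- **Odd-sector columns**: `W_a(1x^j, chiOdd a i) = ((1 − (−1)^j)/√2)·W_a(1x^j, χ_i)` (`a > 0`) — even profiles do not
see the odd sector. -/
theorem weilWindowSesq_indicator_pow_chiOdd (ha : 0 < a) (j i : ℕ) :
    weilWindowSesq a ((Icc (-a) a).indicator fun x : ℝ ↦ ((x : ℂ)) ^ j) (chiOdd a i) =
      (((1 / Real.sqrt 2 : ℝ) : ℂ) * (1 - (-1 : ℂ) ^ j)) *
        weilWindowSesq a ((Icc (-a) a).indicator fun x : ℝ ↦ ((x : ℂ)) ^ j) (chi a i) := by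
  unfold chiOdd
  rw [weilWindowSesq_smul_right, Complex.conj_ofReal, sub_eq_add_neg,
    show -chi a (-(i : ℤ)) = (-1 : ℂ) • chi a (-(i : ℤ)) by rw [neg_one_smul],
    weilWindowSesq_add_right ha.le (isWindowFunction_indicator_pow a j) (isWindowFunction_chi ha _)
      ((isWindowFunction_chi ha _).smul _), weilWindowSesq_smul_right, weilWindowSesq_indicator_pow_chi_neg ha,
    map_neg, map_one]
  ring

end Summit.RiemannHypothesis.RiemannHypothesis.Theorems.WeilFormatC

end
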